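import Summits.QuantumFields.BalabanUV.T4Continuum.Support.T4TrajectoryDensityFreshStep

/-!
# `T4Continuum.T4TrajectoryDensityFreshLaw` — the hypothesis shape `FreshLawUnderBudget` of the per-step bootstrap DERIVED from
# per-family bookkeeping (birth sizes, the one-step size law, a radius floor, transverse fresh defects, the positional count):
# after this leaf the scalar layer of the (w2-obs) reduction has NO packaged hypothesis left (cell `pub-balaban`, sub-cell `t4`,
# spine estimate NE1′ (node O3b/H2), lineage t4-ne1p-p1 = PROVER seat P1 «RG-trajectory comparison», generation 22; tree target
# `Summits/QuantumFields/BalabanUV/T4Continuum/Support/`; ADDITIVE — imports `T4TrajectoryDensityFreshStep` ONLY)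

HONEST FRAMING.  Finite four-torus, rung (B)+1 only — NOT infinite volume, NOT a mass gap, NOT the Clay problem, NOT summit
progress.  «continuum YM on T⁴ ⇐ BetaPertH ∧ nine spine estimates (0/9 proved); BetaPertH ⇐ (D1) ∧ (D4) ∧ CAP+tail; G-an2-4
gates asym, D1 and NE2/3/4».  [folklore] real-number bookkeeping (one induction, one regrouping of a finite sum by birth scale),
0 sorry, 0 citations; the per-family rates are HYPOTHESIS SHAPES of the cell's format, never asserted for Bałaban's densities.

CONTENTS (§14 of the (w2)-split).  `size_le_birth_mul_exp`: under the one-step size law `A_{n+1} ≤ e^{3(s⁰_n+s₁_n)}·A_n` (part 2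
§6) and the budget HISTORY `s⁰_n + s₁_n ≤ 1` for `n < k`, a family born at `j ≤ k` has `A_k ≤ A_j·(e³)^{k−j}`.
`sum_by_birthScale`: a sum over the live families of a function of the birth scale regroups as `Σ_j #{born at j}·g j`.
**`freshLaw_of_pipeline`**: per-family data — live finsets `S k` with birth scales `jb i ≤ k`, sizes `A k i ≥ 0` born `≤ Â·τ^{K−jb i}`
and obeying the size law from birth, radii `≥ r_* > 0`, fresh defects `0 ≤ δ k i ≤ c_δ·ψ^{k−jb i}` (TRANSVERSE (I4′) type),
counts `#{i ∈ S k : jb i = j} ≤ N₀Λ^{k−j}`, and the fresh supplier's budget `s₁ k ≤ c·Σ_{i∈S k} 4A k i / r k i·δ k i` — IMPLY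
`FreshLawUnderBudget s⁰ s₁ (c·4/r_*) N₀ c_δ Â Λ ψ τ K`, hence (with `T4TrajectoryDensityFreshStep.perStep_bootstrap`) the capstone's
per-step budget for all `k < K` under the K-free smallness `c·(4/r_*)·N₀c_δÂ(1−ρ)⁻¹ ≤ 1 − s̄⁰` and the dressed strict product —
`perStep_budget_of_pipeline`.  What stays a binder: every per-family rate above, for Bałaban's densities and the cell's D-terms
(rows (w1), (w2-act), (w3)⁺, (I3)/(I4′), (w7) of record `t4/T4-EST-NE1p-P1.md` §4).
-/

namespace Summit.QuantumFields.BalabanUV.T4Continuum.T4TrajectoryDensityDressed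

open Literature.MathematicalPhysics.QuantumFieldTheory.Balaban1983to89

noncomputable section

section Law

open Finset

/-- **THE ACCUMULATED STEP FACTOR UNDER THE BUDGET HISTORY.**  One-step size law `A_{n+1} ≤ e^{3(s⁰_n+s₁_n)}·A_n` from birth `j`
on, sizes `≥ 0`, and budgets `s⁰_n + s₁_n ≤ 1` for all `n < k`: then `A_k ≤ A_j·(e³)^{k−j}` (`j ≤ k`). [folklore] -/
theorem size_le_birth_mul_exp {A s₀ s₁ : ℕ → ℝ} {j k : ℕ} (hjk : j ≤ k) (hA : ∀ n, 0 ≤ A n)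
    (hrec : ∀ n, j ≤ n → n < k → A (n + 1) ≤ Real.exp (3 * (s₀ n + s₁ n)) * A n)
    (hbud : ∀ n < k, s₀ n + s₁ n ≤ 1) :
    A k ≤ A j * Real.exp 3 ^ (k - j) := by
  obtain ⟨d, rfl⟩ := Nat.exists_eq_add_of_le hjk
  induction d with
  | zero => simp
  | succ d ih =>
    have hrec' : ∀ n, j ≤ n → n < j + d → A (n + 1) ≤ Real.exp (3 * (s₀ n + s₁ n)) * A n :=
      fun n h1 h2 => hrec n h1 (by omega)
    have hbud' : ∀ n < j + d, s₀ n + s₁ n ≤ 1 := fun n hn => hbud n (by omega)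
    have ih' := ih (Nat.le_add_right j d) hrec' hbud'
    have hstep : A (j + d + 1) ≤ Real.exp 3 * A (j + d) :=
      calc A (j + d + 1) ≤ Real.exp (3 * (s₀ (j + d) + s₁ (j + d))) * A (j + d) :=
            hrec (j + d) (Nat.le_add_right j d) (by omega)
        _ ≤ Real.exp 3 * A (j + d) :=
            mul_le_mul_of_nonneg_right (Real.exp_le_exp.mpr (by linarith [hbud (j + d) (by omega)])) (hA _)
    calc A (j + (d + 1)) = A (j + d + 1) := by rw [Nat.add_assoc]
      _ ≤ Real.exp 3 * A (j + d) := hstep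
      _ ≤ Real.exp 3 * (A j * Real.exp 3 ^ (j + d - j)) := mul_le_mul_of_nonneg_left ih' (Real.exp_pos _).le
      _ = A j * Real.exp 3 ^ (j + (d + 1) - j) := by
          rw [show j + d - j = d by omega, show j + (d + 1) - j = d + 1 by omega, pow_succ]
          ring

/-- **REGROUPING A SUM OVER THE LIVE FAMILIES BY BIRTH SCALE**: `Σ_{i∈S} g (jb i) = Σ_{j≤k} #{i ∈ S : jb i = j}·g j` when every
birth scale is `≤ k`. [folklore] -/
theorem sum_by_birthScale {ι : Type*} (S : Finset ι) (jb : ι → ℕ) (g : ℕ → ℝ) {k : ℕ} (hjb : ∀ i ∈ S, jb i ≤ k) :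
    ∑ i ∈ S, g (jb i) = ∑ j ∈ range (k + 1), ((S.filter fun i => jb i = j).card : ℝ) * g j := by
  classical
  rw [← sum_fiberwise_of_maps_to (s := S) (t := range (k + 1)) (g := jb)
    (fun i hi => mem_range_succ_iff.mpr (hjb i hi)) (fun i => g (jb i))]
  refine sum_congr rfl fun j _ => ?_
  rw [sum_congr rfl (fun i hi => by rw [(mem_filter.mp hi).2] : ∀ i ∈ S.filter (fun i => jb i = j), g (jb i) = g j),
    sum_const, nsmul_eq_mul]

variable {ι : Type*}

/-- **`FreshLawUnderBudget` FROM PER-FAMILY BOOKKEEPING.**  Live finsets `S k` (birth scales `jb i ≤ k`), sizes `A k i ≥ 0` with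
births `A (jb i) i ≤ Â·τ^{K−jb i}` and the one-step size law from birth, a radius floor `0 < r_* ≤ r k i`, TRANSVERSE fresh
defects `0 ≤ δ k i ≤ c_δ·ψ^{k−jb i}`, positional counts `#{i ∈ S k : jb i = j} ≤ N₀·Λ^{k−j}`, and the fresh supplier's budget
`s₁ k ≤ c·Σ_{i∈S k} 4 A k i / r k i · δ k i` (`c ≥ 0` ∝ the source strength) give the law with constant `m = c·(4/r_*)`. [folklore] -/
theorem freshLaw_of_pipeline {S : ℕ → Finset ι} {jb : ι → ℕ} {A r δ : ℕ → ι → ℝ} {s₀ s₁ : ℕ → ℝ}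
    {c rstar N₀ cδ Ahat Λ ψ τ : ℝ} {K : ℕ}
    (hc : 0 ≤ c) (hrstar : 0 < rstar) (hcδ : 0 ≤ cδ) (hAhat : 0 ≤ Ahat) (hψ : 0 ≤ ψ) (hτ : 0 ≤ τ)
    (hjb : ∀ k, ∀ i ∈ S k, jb i ≤ k) (hA0 : ∀ n i, 0 ≤ A n i)
    (hbirth : ∀ k, ∀ i ∈ S k, A (jb i) i ≤ Ahat * τ ^ (K - jb i))
    (hrec : ∀ k, ∀ i ∈ S k, ∀ n, jb i ≤ n → n < k → A (n + 1) i ≤ Real.exp (3 * (s₀ n + s₁ n)) * A n i)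
    (hr : ∀ k, ∀ i ∈ S k, rstar ≤ r k i)
    (hδ : ∀ k, ∀ i ∈ S k, 0 ≤ δ k i ∧ δ k i ≤ cδ * ψ ^ (k - jb i))
    (hcount : ∀ k, ∀ j ≤ k, (((S k).filter fun i => jb i = j).card : ℝ) ≤ N₀ * Λ ^ (k - j))
    (hs₁ : ∀ k < K, s₁ k ≤ c * ∑ i ∈ S k, 4 * A k i / r k i * δ k i) :
    FreshLawUnderBudget s₀ s₁ (c * (4 / rstar)) N₀ cδ Ahat Λ ψ τ K := by
  intro k hk hbud
  -- the profile function of the birth scale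
  set g : ℕ → ℝ := fun j => (cδ * (Real.exp 3 * ψ) ^ (k - j)) * (Ahat * τ ^ (K - j)) with hg
  have hg0 : ∀ j, 0 ≤ g j := fun j => by rw [hg]; positivity
  -- per-term bound
  have hterm : ∀ i ∈ S k, 4 * A k i / r k i * δ k i ≤ 4 / rstar * g (jb i) := by
    intro i hi
    have hri : 0 < r k i := lt_of_lt_of_le hrstar (hr k i hi)
    have hAk : A k i ≤ Ahat * τ ^ (K - jb i) * Real.exp 3 ^ (k - jb i) :=
      (size_le_birth_mul_exp (hjb k i hi) (fun n => hA0 n i) (hrec k i hi) hbud).trans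
        (mul_le_mul_of_nonneg_right (hbirth k i hi) (by positivity))
    have h1 : 4 * A k i / r k i ≤ 4 * (Ahat * τ ^ (K - jb i) * Real.exp 3 ^ (k - jb i)) / rstar :=
      calc 4 * A k i / r k i ≤ 4 * A k i / rstar :=
            div_le_div_of_nonneg_left (by linarith [hA0 k i]) hrstar (hr k i hi)
        _ ≤ 4 * (Ahat * τ ^ (K - jb i) * Real.exp 3 ^ (k - jb i)) / rstar :=
            div_le_div_of_nonneg_right (by linarith) hrstar.le
    calc 4 * A k i / r k i * δ k i
        ≤ 4 * (Ahat * τ ^ (K - jb i) * Real.exp 3 ^ (k - jb i)) / rstar * (cδ * ψ ^ (k - jb i)) :=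
          mul_le_mul h1 (hδ k i hi).2 (hδ k i hi).1 (by positivity)
      _ = 4 / rstar * g (jb i) := by
          rw [hg]
          simp only [mul_pow]
          ring
  calc s₁ k ≤ c * ∑ i ∈ S k, 4 * A k i / r k i * δ k i := hs₁ k hk
    _ ≤ c * ∑ i ∈ S k, 4 / rstar * g (jb i) := mul_le_mul_of_nonneg_left (sum_le_sum hterm) hc
    _ = c * (4 / rstar) * ∑ i ∈ S k, g (jb i) := by rw [← mul_sum]; ring
    _ = c * (4 / rstar) * ∑ j ∈ range (k + 1), (((S k).filter fun i => jb i = j).card : ℝ) * g j := by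
        rw [sum_by_birthScale (S k) jb g (hjb k)]
    _ ≤ c * (4 / rstar) * ∑ j ∈ range (k + 1), N₀ * Λ ^ (k - j) * g j := by
        refine mul_le_mul_of_nonneg_left (sum_le_sum fun j hj => ?_) (by positivity)
        exact mul_le_mul_of_nonneg_right (hcount k j (mem_range_succ_iff.mp hj)) (hg0 j)
    _ = c * (4 / rstar) *
          ∑ j ∈ range (k + 1), N₀ * Λ ^ (k - j) * (cδ * (Real.exp 3 * ψ) ^ (k - j)) * (Ahat * τ ^ (K - j)) := by
        congr 1
        refine sum_congr rfl fun j _ => ?_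
        rw [hg]
        ring

/-- **END TO END, SCALAR**: the per-family bookkeeping of `freshLaw_of_pipeline` + a per-step action margin `s⁰ k ≤ s̄⁰` + the
dressed strict product `Λ·(e³ψ)·τ ≤ ρ < 1` (`0 ≤ τ ≤ 1`, `0 ≤ N₀`, `0 ≤ Λ`) + the K-FREE smallness
`c·(4/r_*)·(N₀c_δÂ(1−ρ)⁻¹) ≤ 1 − s̄⁰` ⟹ for every `k < K` the capstone's budget `s⁰ k + s₁ k ≤ 1` and
`s₁ k ≤ c·(4/r_*)·(N₀c_δÂ(1−ρ)⁻¹)·τ^{K−k}` (`perStep_bootstrap` by name). [folklore] -/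
theorem perStep_budget_of_pipeline {S : ℕ → Finset ι} {jb : ι → ℕ} {A r δ : ℕ → ι → ℝ} {s₀ s₁ : ℕ → ℝ}
    {c rstar N₀ cδ Ahat Λ ψ τ ρ sbar : ℝ} {K : ℕ}
    (hc : 0 ≤ c) (hrstar : 0 < rstar) (hN₀ : 0 ≤ N₀) (hcδ : 0 ≤ cδ) (hAhat : 0 ≤ Ahat) (hΛ : 0 ≤ Λ) (hψ : 0 ≤ ψ)
    (hτ0 : 0 ≤ τ) (hτ1 : τ ≤ 1) (hρ1 : ρ < 1) (hprod : Λ * (Real.exp 3 * ψ) * τ ≤ ρ) (hs₀ : ∀ k, s₀ k ≤ sbar)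
    (hjb : ∀ k, ∀ i ∈ S k, jb i ≤ k) (hA0 : ∀ n i, 0 ≤ A n i)
    (hbirth : ∀ k, ∀ i ∈ S k, A (jb i) i ≤ Ahat * τ ^ (K - jb i))
    (hrec : ∀ k, ∀ i ∈ S k, ∀ n, jb i ≤ n → n < k → A (n + 1) i ≤ Real.exp (3 * (s₀ n + s₁ n)) * A n i)
    (hr : ∀ k, ∀ i ∈ S k, rstar ≤ r k i)
    (hδ : ∀ k, ∀ i ∈ S k, 0 ≤ δ k i ∧ δ k i ≤ cδ * ψ ^ (k - jb i))
    (hcount : ∀ k, ∀ j ≤ k, (((S k).filter fun i => jb i = j).card : ℝ) ≤ N₀ * Λ ^ (k - j))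
    (hs₁ : ∀ k < K, s₁ k ≤ c * ∑ i ∈ S k, 4 * A k i / r k i * δ k i)
    (hsmall : c * (4 / rstar) * (N₀ * cδ * Ahat * (1 - ρ)⁻¹) ≤ 1 - sbar) :
    ∀ k < K, s₀ k + s₁ k ≤ 1 ∧ s₁ k ≤ c * (4 / rstar) * (N₀ * cδ * Ahat * (1 - ρ)⁻¹) * τ ^ (K - k) :=
  perStep_bootstrap (mul_nonneg hc (by positivity)) hN₀ hcδ hAhat hΛ hψ hτ0 hτ1 hρ1 hprod hs₀
    (freshLaw_of_pipeline hc hrstar hcδ hAhat hψ hτ0 hjb hA0 hbirth hrec hr hδ hcount hs₁) hsmall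

end Law

end

end Summit.QuantumFields.BalabanUV.T4Continuum.T4TrajectoryDensityDressed
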